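import Mathlib
import HarnessLib
/-!
# Viscous gCLM/OSW profile sheet on the LINE (zone Z3, SHEET-ℝ, case Z3-SR-CERT): the certified point `(a, c_l, ε) = (1/5, 1/2, 1)` —
# transcript of the Newton–Kantorovich certificate of implementation 1, kernel-checked inequalities only
HONEST FRAMING (cell ns-blowup GROUP B «PROFILE SEARCH», human rulings D-0035/D-0074/D-0081; PROFILE-SPEC v1.3 case Z3-SR-CERT, profile-lead
RULING (ay)): **1-D MODEL (viscous gCLM/OSW on `ℝ` at the NS-type similarity exponent `c_l = 1/2`), computer-assisted; not Euler/NS;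
«violates: none — MODEL»; census hook `Literature.Analysis.FluidPDE.effectiveViscosity_half`.** Nothing here is a statement about Navier–Stokes.
The object: odd zeros `Ω : ℝ → ℝ` of the profile map `G(Ω) := Ω + ½ξΩ′ + a𝒰Ω′ − (HΩ)Ω − Ω″`, `𝒰′ = HΩ`, `𝒰(0) = 0`, `a = 1/5`
(`HOME/profile/z3/SHEET.md` §1.2 with `(c_ω, c_l, ε) = (1, 1/2, 1)`; `H` = the line Hilbert transform of `Literature.Analysis.Fourier.HilbertTransformLine`).
FRAME (design of record `HOME/profile/cert/impl1/SHEET-R-PRICE-impl1.md`, prereg `PREREG-SHEET-R-CERT.md`): `E` = odd `H¹` functions with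
`‖δ‖²_E = ‖δ′‖²_w + ¼‖δ‖²_w`, `w = L² + ξ²`, `L = 8`; dual pairing `⟨f, wφ⟩`; `DG(Ω̄) = B_λ − P` with `B_λ = B₀ + a𝒰̄∂ − HΩ̄ + λχ`
(`λ = 4`, `χ = (1 + cos θ)/2`, `ξ = L tan(θ/2)`) coercive on `E` (`⟨B_λδ, wδ⟩ ≥ c_λ‖δ‖²_E`; the backbone part is the kernel identity
`SheetLineBackbone.backbone_energy_identity` at `c = L²`), `P = λχ + Ω̄·H − aΩ̄′·𝒰` finite-rank-approximated through `N` forward and `N` adjoint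
local solves (Woodbury), remainder by the output high-pass lemma (`ε_N`); Newton–Kantorovich in `(E, X*)`
[cite: HungriaLessardMirelesJames2016, Prop. 1] (as `Literature.Analysis.Calculus.existsUnique_zero_of_newtonLike`): with
`‖DG(Ω̄)⁻¹‖_{X*→E} ≤ K`, `‖DG(x) − DG(y)‖ ≤ L_lip‖x − y‖_E`, `η ≥ ‖G(Ω̄)‖_{X*}`, `h := K²·L_lip·η < 1/2` ⇒ EXACTLY ONE zero `Ω*` with
`‖Ω* − Ω̄‖_E ≤ r := (1 − √(1 − 2h))/(K·L_lip)`, and `sup|Ω* − Ω̄| ≤ √2·r/L` by the weighted embedding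
(`SheetRWeightedEmbeddings.abs_le_sqrt_two_div_mul_energy`).
IMPLEMENTATION 1 (seat ns-blowup-profile-cert-1): python-flint/Arb 212-bit balls; centre `Ω̄ = Σ_{k≤768} b_k sin kθ + α₂·L²ξ(L²+ξ²)^{-3/2}`
with exact rational `b_k, α₂`, `Σ(−1)^k k b_k = 0` (file `centre_L8_refit_rational.json`, sha256 prefix `c4de65e13d80c930`); interval outputs
`cert_part1_L8.json` (prefix 039397d0ebede1d8), part-2 shards `706dab6e86246dc4`, `1ff81638092de44c`, `466914ca19a9b43f`, `9afbbacc142d455d`, `cert_part3_L8_N1200.json` (prefix 5263f9519058e74a); code `HOME/profile/cert/impl1/sheetR/code/cert/`.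
IMPLEMENTATION 2 (F5(b), seat profile-cert-4): PENDING — to be APPENDED as `…B` columns with agreement facts; until then the cell's word is
«CERTIFIED MODEL PROFILE (F5(a), one implementation; MODEL)».
1. **Data** — exact literals, decimal OUTWARD roundings of the JSON values: `cLam`, `epsN` (UP), `KNw`, `KNstar` (UP), `K` (UP), `Llip` (UP),
   `eta` (UP), `h` (UP), `rE` (UP), `rSup` (UP); `N L : ℕ`.
2. **Kernel-checked arithmetic** (`norm_num`): `KNw_mul_epsN_lt_one`, `K_ge` (`K ≥ KNstar/(1 − KNw·epsN)`), `h_ge` (`h ≥ K²·Llip·eta`),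
   `h_lt_half`, `rE_ge` (`rE ≥ 2·K·eta ≥ (1 − √(1−2h))/(K L_lip)` via `1 − √(1−2h) ≤ 2h`), `rSup_ge`.
3. NO `def … : Prop` hypotheses. **What is NOT kernel-checked:** (i) that the printed numbers bound the analytic quantities — the ball arithmetic of the
   impl-1 program and its trigonometric-series bookkeeping; (ii) the paper chain: frame identities (E1), (E2), (E4), the output high-pass lemma (E5),
   Lax–Milgram for `B_λ` on `E` from the pointwise potential bound (C1), the Woodbury/adjoint-solve representation and norm formula (C2), the
   perturbation step (C3), and the Newton–Kantorovich theorem in the `(E, X*)` pairing (C4) with the Lipschitz constant. KERNEL-checked elsewhere: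
   the backbone identity (`SheetLineBackbone.backbone_energy_identity`), the weighted embeddings/velocity bound
   (`SheetRWeightedEmbeddings`, `Literature.Analysis.Fourier.HilbertTransformLineVelocityBound`), the abstract NK theorem
   (`Literature.Analysis.Calculus.RadiiPolynomial`), and the inequalities below.
-/

namespace Summit.NavierStokesRegularity.OSWSelfSimilar
namespace CertificateViscousSheetR

/-- Cayley scale `L` of the frame (`ξ = L tan(θ/2)`, `w = L² + ξ²`). [folklore] -/
def L : ℕ := 8
/-- Finite rank `N` of the Woodbury part (number of forward and of adjoint local solves). [folklore] -/
def N : ℕ := 1200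
/-- The model parameter `a = 1/5`. [folklore] -/
def a : ℚ := (1 : ℚ) / 5
/-- Coercivity constant `c_λ` of `B_λ` on `E` (certified: `κ_λ − 1/4 ≥ 0` on `[0, π)`). [folklore] -/
def cLam : ℚ := 1
/-- `ε_N ≥ ‖Π_T P‖_{E → L²_w}` at `N = 1200` (UP). [folklore] -/
def epsN : ℚ := (114569 : ℚ) / 2000000
/-- `K_Nw ≥ ‖(B_λ − Π_H P)⁻¹‖_{L²_w → E}` (UP). [folklore] -/
def KNw : ℚ := (31267 : ℚ) / 5000
/-- `K_N* ≥ ‖(B_λ − Π_H P)⁻¹‖_{X* → E}` (UP). [folklore] -/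
def KNstar : ℚ := (42039 : ℚ) / 10000
/-- `K ≥ ‖DG(Ω̄)⁻¹‖_{X* → E}` (UP). [folklore] -/
def K : ℚ := (13101 : ℚ) / 2000
/-- `L_lip`: Lipschitz constant of `DG` as a map `E → B(E, X*)` (UP). [folklore] -/
def Llip : ℚ := (95777 : ℚ) / 50000
/-- `η ≥ ‖G(Ω̄)‖_{X*}` (UP). [folklore] -/
def eta : ℚ := (90701 : ℚ) / 100000000000
/-- `h ≥ K²·L_lip·η` (UP). [folklore] -/
def h : ℚ := (233 : ℚ) / 3125000
/-- `r_E`: radius of the certified ball in `E` (UP; `≥ 2Kη ≥ (1 − √(1−2h))/(K L_lip)`). [folklore] -/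
def rE : ℚ := (1189 : ℚ) / 100000000
/-- `r_sup ≥ √2·r_E/L ≥ sup|Ω* − Ω̄|` (UP). [folklore] -/
def rSup : ℚ := (1051 : ℚ) / 500000000

/-- The perturbation step closes: `K_Nw·ε_N < 1`. [folklore] -/
theorem KNw_mul_epsN_lt_one : KNw * epsN < 1 := by norm_num [KNw, epsN]
/-- `K` dominates `K_N*/(1 − K_Nw ε_N)`. [folklore] -/
theorem K_ge : KNstar / (1 - KNw * epsN) ≤ K := by norm_num [KNstar, KNw, epsN, K]
/-- `h` dominates `K²·L_lip·η`. [folklore] -/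
theorem h_ge : K ^ 2 * Llip * eta ≤ h := by norm_num [K, Llip, eta, h]
/-- The Newton–Kantorovich discriminant is below `1/2`. [folklore] -/
theorem h_lt_half : h < 1 / 2 := by norm_num [h]
/-- `r_E ≥ 2Kη` (and `2Kη ≥ (1 − √(1 − 2h))/(K·L_lip)` since `1 − √(1−2h) ≤ 2h = 2K²L_lipη`). [folklore] -/
theorem rE_ge : 2 * K * eta ≤ rE := by norm_num [K, eta, rE]
/-- `r_sup² ≥ 2 r_E²/L²` (so `r_sup ≥ √2 r_E / L`). [folklore] -/
theorem rSup_sq_ge : 2 * rE ^ 2 / (L : ℚ) ^ 2 ≤ rSup ^ 2 := by norm_num [rE, rSup, L]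


/-! ### Append (seat ns-blowup-profile-cert-1 g4, 2026-08-26): the SHARP Newton–Kantorovich radius at the literals, kernel-side
The row above certifies the crude radius `rE = 2Kη`; the RESULT word of record quotes the NK radius
`r = (1 − √(1 − 2h))/(K·L_lip)` itself (program value `5.9414e-6`). At the UP-rounded literals `K, Llip, h` the NK radius is
`≤ rE♯ := 5.943e-6` (monotone in `K·L_lip` and in `h`, so UP-rounded inputs give an UPPER bound), checked here WITHOUT the program:
`(1 − rE♯·K·L_lip)² ≤ 1 − 2h` with `1 − rE♯·K·L_lip ≥ 0`, then the real square-root form. MODEL bookkeeping; not NS. -/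

/-- Sharp energy-radius literal `rE♯ = 5.943e-6 ≥ (1 − √(1 − 2h))/(K·L_lip)` (UP). [folklore] -/
def rEsharp : ℚ := (5943 : ℚ) / 1000000000
/-- Sharp sup-radius literal `rSup♯ = 1.0506e-6 ≥ √2·rE♯/L ≥ sup|Ω* − Ω̄|` (UP). [folklore] -/
def rSupSharp : ℚ := (10506 : ℚ) / 10000000000

/-- `0 ≤ 1 − rE♯·K·L_lip` (squaring below is legitimate). [folklore] -/
theorem one_sub_rEsharp_mul_nonneg : 0 ≤ 1 - rEsharp * K * Llip := by norm_num [rEsharp, K, Llip]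
/-- `(1 − rE♯·K·L_lip)² ≤ 1 − 2h`, i.e. `rE♯ ≥ (1 − √(1 − 2h))/(K·L_lip)` — the NK existence radius at the literals. [folklore] -/
theorem rEsharp_sq_le : (1 - rEsharp * K * Llip) ^ 2 ≤ 1 - 2 * h := by norm_num [rEsharp, K, Llip, h]
/-- `rE♯ ≤ rE` (the sharp literal improves the crude `2Kη` literal). [folklore] -/
theorem rEsharp_le_rE : rEsharp ≤ rE := by norm_num [rEsharp, rE]
/-- `rSup♯² ≥ 2·rE♯²/L²` (so `rSup♯ ≥ √2·rE♯/L`). [folklore] -/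
theorem rSupSharp_sq_ge : 2 * rEsharp ^ 2 / (L : ℚ) ^ 2 ≤ rSupSharp ^ 2 := by norm_num [rEsharp, rSupSharp, L]

/-- Real form: the Newton–Kantorovich radius `(1 − √(1 − 2h))/(K·L_lip)` at the literals is at most `rE♯ = 5.943e-6`. [folklore] -/
theorem nk_radius_le_rEsharp :
    (1 - Real.sqrt (1 - 2 * (h : ℝ))) / ((K : ℝ) * (Llip : ℝ)) ≤ (rEsharp : ℝ) := by
  have hKL : (0 : ℝ) < (K : ℝ) * (Llip : ℝ) := by norm_num [K, Llip]
  have h0 : (0 : ℝ) ≤ 1 - (rEsharp : ℝ) * K * Llip := by exact_mod_cast one_sub_rEsharp_mul_nonneg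
  have h1 : (1 - (rEsharp : ℝ) * K * Llip) ^ 2 ≤ 1 - 2 * (h : ℝ) := by exact_mod_cast rEsharp_sq_le
  have h2 : 1 - (rEsharp : ℝ) * K * Llip ≤ Real.sqrt (1 - 2 * (h : ℝ)) := Real.le_sqrt_of_sq_le h1
  rw [div_le_iff₀ hKL]
  nlinarith [h2]


/-! ### Append 2 (seat ns-blowup-profile-cert-1 g4, 2026-08-27): the chain re-run under the CONSERVATIVE high-pass constant
profile-refuter g4 (K-NOTE 2026-08-27T00:01Z) and profile-cert-2 g4 (F5(b) part 1) observed that the rigorous majorant `D` of the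
output high-pass lemma (E5) must bound the piece `‖𝒰δ‖_{L²(dθ)}` by the VOLTERRA constant `2·(2L)^{-1/2}‖δ‖_w = 4·(2L)^{-1/2}‖δ‖_E`
(the design memo used `2·(2L)^{-1/2}‖δ‖_E`). With impl-1's certified `S₂′ ≤ 4.84337` this gives `D ≤ 2.63429` (was `2.14996`) and
`ε_N = 32·D/1201 ≤ 0.07020` at `N = 1200`. The literals below re-run the SAME chain (`KNw`, `KNstar`, `Llip`, `eta` unchanged — they do
not depend on `D`): the certificate still closes (`K_Nw·ε_N < 1`, `h < 1/2`), with `K ≤ 7.494`, `h ≤ 9.76e-5`, NK radius `≤ 6.80e-6`,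
`sup ≤ 1.203e-6`. The first-block literals remain the values under the design memo's constant. MODEL bookkeeping; not NS. -/

/-- Conservative `ε_N` (UP) under the Volterra bound for `‖𝒰δ‖`: `32·2.63429/1201 ≤ 0.0702`. [folklore] -/
def epsN2 : ℚ := (702 : ℚ) / 10000
/-- Conservative `K ≥ K_N*/(1 − K_Nw·ε_N)` (UP). [folklore] -/
def K2 : ℚ := (7494 : ℚ) / 1000
/-- Conservative `h ≥ K²·L_lip·η` (UP). [folklore] -/
def h2 : ℚ := (976 : ℚ) / 10000000
/-- Conservative crude radius `rE ≥ 2Kη` (UP). [folklore] -/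
def rE2 : ℚ := (136 : ℚ) / 10000000
/-- Conservative sharp NK radius literal (UP). [folklore] -/
def rEsharp2 : ℚ := (680 : ℚ) / 100000000
/-- Conservative sharp sup radius literal `≥ √2·rE♯/L` (UP). [folklore] -/
def rSupSharp2 : ℚ := (1203 : ℚ) / 1000000000

/-- The perturbation step still closes under the conservative `ε_N`: `K_Nw·ε_N < 1`. [folklore] -/
theorem KNw_mul_epsN2_lt_one : KNw * epsN2 < 1 := by norm_num [KNw, epsN2]
/-- `epsN2` dominates the first-block literal (the conservative constant is larger). [folklore] -/
theorem epsN_le_epsN2 : epsN ≤ epsN2 := by norm_num [epsN, epsN2]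
/-- `K2 ≥ K_N*/(1 − K_Nw·ε_N)` under the conservative `ε_N`. [folklore] -/
theorem K2_ge : KNstar / (1 - KNw * epsN2) ≤ K2 := by norm_num [KNstar, KNw, epsN2, K2]
/-- `h2 ≥ K2²·L_lip·η`. [folklore] -/
theorem h2_ge : K2 ^ 2 * Llip * eta ≤ h2 := by norm_num [K2, Llip, eta, h2]
/-- The Newton–Kantorovich discriminant stays below `1/2` under the conservative constant. [folklore] -/
theorem h2_lt_half : h2 < 1 / 2 := by norm_num [h2]
/-- `rE2 ≥ 2·K2·η`. [folklore] -/
theorem rE2_ge : 2 * K2 * eta ≤ rE2 := by norm_num [K2, eta, rE2]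
/-- `0 ≤ 1 − rE♯₂·K2·L_lip`. [folklore] -/
theorem one_sub_rEsharp2_mul_nonneg : 0 ≤ 1 - rEsharp2 * K2 * Llip := by norm_num [rEsharp2, K2, Llip]
/-- `(1 − rE♯₂·K2·L_lip)² ≤ 1 − 2h2`: `rE♯₂` bounds the NK existence radius under the conservative constant. [folklore] -/
theorem rEsharp2_sq_le : (1 - rEsharp2 * K2 * Llip) ^ 2 ≤ 1 - 2 * h2 := by norm_num [rEsharp2, K2, Llip, h2]
/-- `rSup♯₂² ≥ 2·rE♯₂²/L²`. [folklore] -/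
theorem rSupSharp2_sq_ge : 2 * rEsharp2 ^ 2 / (L : ℚ) ^ 2 ≤ rSupSharp2 ^ 2 := by norm_num [rEsharp2, rSupSharp2, L]
/-- Real form: the NK radius `(1 − √(1 − 2h2))/(K2·L_lip)` is at most `rE♯₂ = 6.80e-6`. [folklore] -/
theorem nk_radius_le_rEsharp2 :
    (1 - Real.sqrt (1 - 2 * (h2 : ℝ))) / ((K2 : ℝ) * (Llip : ℝ)) ≤ (rEsharp2 : ℝ) := by
  have hKL : (0 : ℝ) < (K2 : ℝ) * (Llip : ℝ) := by norm_num [K2, Llip]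
  have h1 : (1 - (rEsharp2 : ℝ) * K2 * Llip) ^ 2 ≤ 1 - 2 * (h2 : ℝ) := by exact_mod_cast rEsharp2_sq_le
  have hsq : 1 - (rEsharp2 : ℝ) * K2 * Llip ≤ Real.sqrt (1 - 2 * (h2 : ℝ)) := Real.le_sqrt_of_sq_le h1
  rw [div_le_iff₀ hKL]
  nlinarith [hsq]

end CertificateViscousSheetR
end Summit.NavierStokesRegularity.OSWSelfSimilar
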